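import Mathlib
import Summits.NavierStokesRegularity.NavierStokesRegularity.Theorems.PowerGaugeEulerLiouville.Negative.RelaxingFlowFatVorticity

/-!
# Crux `EulerZoomLiouville.PowerGaugeEulerLiouville` (stmt-NavierStokesRegularity-19832) — fat vorticity WITHOUT compact support:
# finite vortex VOLUME already forces infinite space–time enstrophy under an energy floor

Negative-lane structure record (prover hand leafhand-ns-eulerzoomliouville-8 g0; `--supports` stmt-19832).  The volume-slaving
inequality of the line `vortex-volume` (`CompactVortex.vortexVolumeEnergyIneq`) is stated for continuous COMPACTLY SUPPORTED
vorticities although, as its own docstring records, compact support is not used.  This file re-runs that proof for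
MEASURABLE vorticities (`vortexVolumeEnergyIneq_of_measurable`: `∫|K₃∗ω|² ≤ C·vol(supp ω)^{2/3}·∫|ω|²`, support of any
— possibly infinite — volume), and upgrades the fat-vorticity law of `…Negative.RelaxingFlowFatVorticity` accordingly:

* `energy_le_vortexVolume_mul_enstrophy'` — `C²` divergence-free `v` with `v, curl v ∈ L²`: `∫|v|² ≤ C·vol(supp curl v)^{2/3}·∫|curl v|²`;
* `setLIntegral_enstrophy_eq_top_of_energyFloor'` / `no_thinVorticity_relaxingFlow'` — energy floor `E₀ > 0` and vortex
  VOLUME `≤ V₀ < ∞` (no compactness) ⇒ `∫∫_{(0,∞)×ℝ³}|∇v|²_F = ∞`; so a forward relaxing flow refuting X_E spreads its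
  vorticity over sets of unbounded VOLUME.

WHAT THIS IS NOT: not a refutation or proof of the crux, of a stub, or of the route; not a claim about Navier–Stokes.
[cite: Stein1971, Ch. V §1.2 Theorem 1 (b), via the tree's `lintegral_rieszPotential_rpow_le'`] -/

noncomputable section
set_option linter.dupNamespace false
namespace Summit.NavierStokesRegularity.NavierStokesRegularity.Theorems.PowerGaugeEulerLiouville.Negative

open MeasureTheory Set Function Filter Topology Metric Literature.Analysis Literature.Analysis.FluidPDE
open Literature.Analysis.SingularIntegrals
open scoped NNReal ENNReal

/-- **THE VOLUME-SLAVING INEQUALITY for measurable vorticities** (proof of `CompactVortex.vortexVolumeEnergyIneq` with the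
unused compact-support binder dropped): `∫‖(K₃ ∗ ω)(x)‖² dx ≤ C · vol(supp ω)^{2/3} · ∫‖ω‖²`. [cite: Stein1971, Ch. V §1.2 Theorem 1 (b)] -/
theorem vortexVolumeEnergyIneq_of_measurable :
    ∃ C : ℝ≥0, ∀ ω : EuclideanSpace ℝ (Fin 3) → EuclideanSpace ℝ (Fin 3), Measurable ω →
      ∫⁻ x, ‖biotSavart ω x‖ₑ ^ 2 ≤
        (C : ℝ≥0∞) * volume (Function.support ω) ^ (2 / 3 : ℝ) * ∫⁻ x, ‖ω x‖ₑ ^ 2 := by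
  obtain ⟨C, hC, hHLS⟩ := lintegral_rieszPotential_rpow_le' (μ := (volume : Measure (EuclideanSpace ℝ (Fin 3))))
    (p := 6 / 5) (α := 1) (by norm_num) one_pos (by rw [finrank_real_euclideanSpace_fin_three]; norm_num)
  set c₀ : ℝ≥0∞ := ENNReal.ofReal (4 * Real.pi)⁻¹ with hc₀
  have hc₀t : c₀ ≠ ⊤ := ENNReal.ofReal_ne_top
  set K : ℝ≥0∞ := c₀ ^ 2 * C ^ (2 : ℝ) with hK
  have hKt : K ≠ ⊤ := ENNReal.mul_ne_top (ENNReal.pow_ne_top hc₀t) (ENNReal.rpow_ne_top_of_nonneg (by norm_num) hC.ne)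
  refine ⟨K.toNNReal, fun ω hω => ?_⟩
  rw [ENNReal.coe_toNNReal hKt]
  set Φ : EuclideanSpace ℝ (Fin 3) → ℝ≥0∞ := fun y => (‖ω y‖ₑ : ℝ≥0∞) with hΦ
  have hΦm : Measurable Φ := hω.enorm
  set I : EuclideanSpace ℝ (Fin 3) → ℝ≥0∞ := rieszPotential volume 1 Φ with hI
  have hpt : ∀ x, ‖biotSavart ω x‖ₑ ^ 2 ≤ c₀ ^ 2 * I x ^ (2 : ℝ) := by
    intro x
    have h := enorm_biotSavart_le_rieszPotential ω x
    calc ‖biotSavart ω x‖ₑ ^ 2 ≤ (c₀ * I x) ^ 2 := pow_le_pow_left' h 2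
      _ = c₀ ^ 2 * I x ^ (2 : ℝ) := by rw [mul_pow, ENNReal.rpow_two]
  have hHLS' := hHLS Φ hΦm.aemeasurable
  rw [finrank_real_euclideanSpace_fin_three, show (3 : ℝ) * (6 / 5) / (3 - 1 * (6 / 5)) = 2 by norm_num] at hHLS'
  have h2 := ENNReal.rpow_le_rpow hHLS' (show (0 : ℝ) ≤ 2 by norm_num)
  rw [← ENNReal.rpow_mul, show (1 / (2 : ℝ)) * 2 = 1 by norm_num, ENNReal.rpow_one,
    ENNReal.mul_rpow_of_nonneg _ _ (show (0 : ℝ) ≤ 2 by norm_num), ← ENNReal.rpow_mul,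
    show (1 / (6 / 5 : ℝ)) * 2 = 5 / 3 by norm_num] at h2
  have h3 : (∫⁻ y, Φ y ^ (6 / 5 : ℝ)) ^ (5 / 3 : ℝ) ≤
      (∫⁻ y, Φ y ^ (2 : ℝ)) * volume (Function.support Φ) ^ (2 / 3 : ℝ) := by
    have h := ENNReal.rpow_le_rpow (CompactVortex.lintegral_rpow_sixFifths_le hΦm) (show (0 : ℝ) ≤ 5 / 3 by norm_num)
    rw [ENNReal.mul_rpow_of_nonneg _ _ (show (0 : ℝ) ≤ 5 / 3 by norm_num), ← ENNReal.rpow_mul, ← ENNReal.rpow_mul,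
      show (3 / 5 : ℝ) * (5 / 3) = 1 by norm_num, show (2 / 5 : ℝ) * (5 / 3) = 2 / 3 by norm_num, ENNReal.rpow_one] at h
    exact h
  have hsuppΦ : Function.support Φ = Function.support ω := by
    ext y; simp [hΦ]
  have hsq : ∀ y, Φ y ^ (2 : ℝ) = ‖ω y‖ₑ ^ 2 := fun y => by rw [hΦ, ENNReal.rpow_two]
  simp_rw [hsuppΦ, hsq] at h3
  calc ∫⁻ x, ‖biotSavart ω x‖ₑ ^ 2 ≤ ∫⁻ x, c₀ ^ 2 * I x ^ (2 : ℝ) := lintegral_mono hpt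
    _ = c₀ ^ 2 * ∫⁻ x, I x ^ (2 : ℝ) := by
        rw [lintegral_const_mul' _ _ (ENNReal.pow_ne_top hc₀t)]
    _ ≤ c₀ ^ 2 * (C ^ (2 : ℝ) * (∫⁻ y, Φ y ^ (6 / 5 : ℝ)) ^ (5 / 3 : ℝ)) := by gcongr
    _ ≤ c₀ ^ 2 * (C ^ (2 : ℝ) * ((∫⁻ y, ‖ω y‖ₑ ^ 2) * volume (Function.support ω) ^ (2 / 3 : ℝ))) := by gcongr
    _ = K * volume (Function.support ω) ^ (2 / 3 : ℝ) * ∫⁻ x, ‖ω x‖ₑ ^ 2 := by rw [hK]; ring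

/-- **Energy ≤ C · (vortex volume)^{2/3} · enstrophy, no compact support.**  `C²` divergence-free `v` on `ℝ³` with
`∫|v|² < ∞`, `∫|curl v|² < ∞`: `∫|v|² ≤ C · vol(supp curl v)^{2/3} · ∫|curl v|²`. [folklore] -/
theorem energy_le_vortexVolume_mul_enstrophy' :
    ∃ C : ℝ≥0, ∀ v : EuclideanSpace ℝ (Fin 3) → EuclideanSpace ℝ (Fin 3), ContDiff ℝ 2 v →
      VectorCalculus.IsDivFree v → ∫⁻ x, ‖v x‖ₑ ^ 2 < ⊤ → ∫⁻ x, ‖curl v x‖ₑ ^ 2 < ⊤ →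
      ∫⁻ x, ‖v x‖ₑ ^ 2 ≤
        (C : ℝ≥0∞) * volume (Function.support (curl v)) ^ (2 / 3 : ℝ) * ∫⁻ x, ‖curl v x‖ₑ ^ 2 := by
  obtain ⟨C, hC⟩ := vortexVolumeEnergyIneq_of_measurable
  refine ⟨C, fun v hv hdiv hv2 hω2 => ?_⟩
  have hωm : Measurable (curl v) := (continuous_curl (hv.of_le (by norm_num))).measurable
  have h := hC (curl v) hωm
  rwa [biotSavart_curl_eq_self_of_lintegral_sq_lt_top hv hdiv hv2 hω2] at h

/-- **ENERGY FLOOR + FINITE VORTEX VOLUME ⇒ INFINITE SPACE–TIME ENSTROPHY** (no compact support).  As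
`setLIntegral_enstrophy_eq_top_of_energyFloor` with the compact-support hypothesis on the vorticity slices removed. [folklore] -/
theorem setLIntegral_enstrophy_eq_top_of_energyFloor'
    {v : ℝ → EuclideanSpace ℝ (Fin 3) → EuclideanSpace ℝ (Fin 3)}
    (hv : ContDiffOn ℝ 1 (uncurry v) (Ioi (0 : ℝ) ×ˢ (univ : Set (EuclideanSpace ℝ (Fin 3)))))
    (hC2 : ∀ s : ℝ, 0 < s → ContDiff ℝ 2 (v s)) (hdiv : ∀ s : ℝ, 0 < s → VectorCalculus.IsDivFree (v s))
    (hfin : ∀ s : ℝ, 0 < s → ∫⁻ x, ‖v s x‖ₑ ^ 2 < ⊤)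
    (hωfin : ∀ s : ℝ, 0 < s → ∫⁻ x, ‖curl (v s) x‖ₑ ^ 2 < ⊤)
    {E₀ V₀ : ℝ≥0∞} (hE₀ : E₀ ≠ 0) (hV₀ : V₀ ≠ ⊤)
    (hfloor : ∀ s : ℝ, 0 < s → E₀ ≤ ∫⁻ x, ‖v s x‖ₑ ^ 2)
    (hvol : ∀ s : ℝ, 0 < s → volume (Function.support (curl (v s))) ≤ V₀) :
    ∫⁻ z in Ioi (0 : ℝ) ×ˢ (univ : Set (EuclideanSpace ℝ (Fin 3))),
      ENNReal.ofReal (frobeniusNormSq (fderiv ℝ (v z.1) z.2)) = ⊤ := by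
  obtain ⟨C, hC⟩ := energy_le_vortexVolume_mul_enstrophy'
  set K : ℝ≥0∞ := (C : ℝ≥0∞) * V₀ ^ (2 / 3 : ℝ) * 2 with hK
  have hKtop : K ≠ ⊤ := ENNReal.mul_ne_top
    (ENNReal.mul_ne_top ENNReal.coe_ne_top (ENNReal.rpow_ne_top_of_nonneg (by norm_num) hV₀)) (by norm_num)
  set Φ : ℝ → ℝ≥0∞ := fun s => ∫⁻ x, ENNReal.ofReal (frobeniusNormSq (fderiv ℝ (v s) x)) with hΦ
  have hslice : ∀ s : ℝ, 0 < s → E₀ / K ≤ Φ s := by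
    intro s hs
    refine ENNReal.div_le_of_le_mul ?_
    calc E₀ ≤ ∫⁻ x, ‖v s x‖ₑ ^ 2 := hfloor s hs
      _ ≤ (C : ℝ≥0∞) * volume (Function.support (curl (v s))) ^ (2 / 3 : ℝ) * ∫⁻ x, ‖curl (v s) x‖ₑ ^ 2 :=
          hC (v s) (hC2 s hs) (hdiv s hs) (hfin s hs) (hωfin s hs)
      _ ≤ (C : ℝ≥0∞) * V₀ ^ (2 / 3 : ℝ) * (2 * Φ s) := by
          gcongr
          · exact hvol s hs
          · exact lintegral_enorm_curl_sq_le_two_mul (v s)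
      _ = Φ s * K := by rw [hK]; ring
  have hφ0 : E₀ / K ≠ 0 := (ENNReal.div_pos_iff.2 ⟨hE₀, hKtop⟩).ne'
  have hslice_cont : ContinuousOn (fun z : ℝ × EuclideanSpace ℝ (Fin 3) => fderiv ℝ (v z.1) z.2)
      (Ioi (0 : ℝ) ×ˢ (univ : Set (EuclideanSpace ℝ (Fin 3)))) :=
    continuousOn_fderiv_slice_of_contDiffOn hv isOpen_Ioi.uniqueDiffOn
  have hFcont : ContinuousOn
      (fun z : ℝ × EuclideanSpace ℝ (Fin 3) => ENNReal.ofReal (frobeniusNormSq (fderiv ℝ (v z.1) z.2)))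
      (Ioi (0 : ℝ) ×ˢ (univ : Set (EuclideanSpace ℝ (Fin 3)))) :=
    ENNReal.continuous_ofReal.comp_continuousOn
      (LerayHopfProofs.continuous_frobeniusNormSq.comp_continuousOn hslice_cont)
  have hmeas : MeasurableSet (Ioi (0 : ℝ) ×ˢ (univ : Set (EuclideanSpace ℝ (Fin 3)))) :=
    measurableSet_Ioi.prod MeasurableSet.univ
  have hF : AEMeasurable
      (fun z : ℝ × EuclideanSpace ℝ (Fin 3) => ENNReal.ofReal (frobeniusNormSq (fderiv ℝ (v z.1) z.2)))
      (((volume : Measure ℝ).prod (volume : Measure (EuclideanSpace ℝ (Fin 3)))).restrict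
        (Ioi (0 : ℝ) ×ˢ (univ : Set (EuclideanSpace ℝ (Fin 3))))) := by
    rw [← Measure.volume_eq_prod]
    exact hFcont.aemeasurable hmeas
  rw [Measure.volume_eq_prod, setLIntegral_prod _ hF]
  simp only [Measure.restrict_univ]
  refine eq_top_iff.2 ?_
  calc (⊤ : ℝ≥0∞) = E₀ / K * volume (Ioi (0 : ℝ)) := by rw [Real.volume_Ioi, ENNReal.mul_top hφ0]
    _ = ∫⁻ _ in Ioi (0 : ℝ), E₀ / K := (setLIntegral_const _ _).symm
    _ ≤ ∫⁻ s in Ioi (0 : ℝ), Φ s := setLIntegral_mono' measurableSet_Ioi fun s hs => hslice s hs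

/-- **NO FINITE-VORTEX-VOLUME RELAXING FLOW** (no compact support).  A jointly `C¹` velocity on `(0,∞) × ℝ³` with `C²`
divergence-free `L²` slices of finite enstrophy, an energy floor `E₀ > 0`, vortex volume `vol(supp curl v(s)) ≤ V₀ < ∞`, and a
finite space–time enstrophy budget does not exist. [folklore] -/
theorem no_thinVorticity_relaxingFlow'
    {v : ℝ → EuclideanSpace ℝ (Fin 3) → EuclideanSpace ℝ (Fin 3)} {M : ℝ≥0}
    (hv : ContDiffOn ℝ 1 (uncurry v) (Ioi (0 : ℝ) ×ˢ (univ : Set (EuclideanSpace ℝ (Fin 3)))))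
    (hC2 : ∀ s : ℝ, 0 < s → ContDiff ℝ 2 (v s)) (hdiv : ∀ s : ℝ, 0 < s → VectorCalculus.IsDivFree (v s))
    (hfin : ∀ s : ℝ, 0 < s → ∫⁻ x, ‖v s x‖ₑ ^ 2 < ⊤)
    (hωfin : ∀ s : ℝ, 0 < s → ∫⁻ x, ‖curl (v s) x‖ₑ ^ 2 < ⊤)
    {E₀ V₀ : ℝ≥0∞} (hE₀ : E₀ ≠ 0) (hV₀ : V₀ ≠ ⊤)
    (hfloor : ∀ s : ℝ, 0 < s → E₀ ≤ ∫⁻ x, ‖v s x‖ₑ ^ 2)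
    (hvol : ∀ s : ℝ, 0 < s → volume (Function.support (curl (v s))) ≤ V₀)
    (hE : ∫⁻ z in Ioi (0 : ℝ) ×ˢ (univ : Set (EuclideanSpace ℝ (Fin 3))),
      ENNReal.ofReal (frobeniusNormSq (fderiv ℝ (v z.1) z.2)) ≤ (M : ℝ≥0∞)) : False := by
  have h := setLIntegral_enstrophy_eq_top_of_energyFloor' hv hC2 hdiv hfin hωfin hE₀ hV₀ hfloor hvol
  rw [h] at hE
  exact ENNReal.coe_ne_top (top_le_iff.1 hE)

end Summit.NavierStokesRegularity.NavierStokesRegularity.Theorems.PowerGaugeEulerLiouville.Negative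
end
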